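import Mathlib
import HarnessLib

/-!
# X5 / O1 (p = 2), lens-2 "Selmer solitaire": alternating matrices over `𝔽₂` — the generic
# linear-algebra lemmas behind PivotRebase / T4 / T4′ (support file; pure `Matrix` facts)

HONEST FRAMING (cell `b2b-bsdres`, run/shared/lean/b2b/bsd-rank1-residual/, verbatim in every
file): the goal of the cell is to DELETE the COMBINATION-SHAPED residual classes of the
Birch–Swinnerton-Dyer formula for ALL analytic-rank `≤ 1` elliptic curves over `ℚ` — assembled
STRICTLY from published theorems — so that the rank-`≤ 1` remainder becomes exactly the
CONSTRUCTION-SHAPED classes, which are TYPED (missing-input `Prop`s), NOT attempted. This is not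
"finishing BSD". Cell O1 (`p = 2`): research route; O1 OPEN; nothing booked; no mark / label / count
moved. THEOREMS ONLY (no definition, no named fact, no `sorry`); imports `Mathlib` + `HarnessLib` only;
reach-neutral.

WHAT THIS FILE IS. The o1 PROVER ORDER v2.8 (ii′) asks for lens-2's stub₂′ `OnePrimeConnection` (T4),
its companion T4′ and stub₂″ `PivotRebase` (word-shapes `HOME/b2b-bsdres-o1-idea-2-g5/lean/
O1Stub2Sketch.lean`, G5.10) as stand-alone pure-`𝔽₂` linear algebra. All three live on ONE object: a
symmetric matrix `S` over `ZMod 2` with zero diagonal (the adjacency matrix of the position graph `Γ̂`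
on `D ⊔ {∞}`), i.e. an ALTERNATING matrix in characteristic `2`, and its principal minors
(`core n ⟺ det S[n⁺] = 1`). This file supplies the generic facts about such matrices that every one
of the three proofs consumes, as importable lemmas about bare `Matrix n n (ZMod 2)` /
`Matrix n n R` with `CharP R 2` — it does NOT copy, restate or specialise any declaration of the
sketch (no `Position`, `Core`, …), which the (ii′) holder's file declares.

## Contents

* §1 `quadForm_eq_zero` — `v ⬝ᵥ (S *ᵥ v) = 0` for symmetric zero-diagonal `S` in characteristic `2`
  (the terms `(i,j)`/`(j,i)` cancel in pairs, the diagonal is zero); `diag_conj_eq_zero` /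
  `isSymm_conj` — hence `C * S * Cᵀ` is again symmetric with zero diagonal for ANY `C` (the
  Schur-complement / principal-pivot shape `S₂₂ + S₂₁ S₁₁⁻¹ S₁₂`).
* §2 `inv_diag_eq_zero`, `inv_isSymm_and_diag_eq_zero` — the inverse of a NONSINGULAR symmetric
  zero-diagonal matrix is symmetric with zero diagonal (`(S⁻¹)ᵢᵢ = wᵀ S w` for the column `w` of
  `S⁻¹`, then §1) — "the inverse of an alternating matrix is alternating", char `2` included.
* §3 `det_eq_zero_of_card_odd` — over `ZMod 2` a symmetric zero-diagonal matrix of ODD size is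
  SINGULAR (pair `σ ↔ σ⁻¹` in the Leibniz sum; an involution of an odd set has a fixed point, which
  meets the zero diagonal); `even_card_of_det_ne_zero` — so nonsingular ⟹ even size (why `n⁺`
  adjoins `∞` exactly when `|n|` is odd).
* §4 `ZMod 2` bookkeeping the core predicate uses: `det_eq_one_iff_det_ne_zero`,
  `det_ne_zero_iff_forall_mulVec` (`det S ≠ 0 ⟺ S *ᵥ v = 0 → v = 0`, Mathlib's
  `Matrix.exists_mulVec_eq_zero_iff`).
* §5 the explicit-argument `ZMod 2` shapes the (ii′) holder's `X5/SelmerSolitairePivot.lean`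
  consumes BY NAME (agreed on INBOX): `dotProduct_mulVec_self_eq_zero`,
  `nonsing_inv_apply_self_eq_zero`, `isSymm_nonsing_inv_of_isSymm`.

References: lens-2 GEN 5 addendum G5.2 (T3 normal form), G5.3 (T4, proof Steps 1–4), G5.9 (T4′),
G5.10 (sketch) — `HOME/b2b-bsdres-o1-idea-2-g5/G5-addendum.md`; A. W. Tucker, "A combinatorial
equivalence of matrices" (1960) and A. Bouchet, "Representability of Δ-matroids" (1988) for the
principal pivot transform over `𝔽₂` (background only; nothing cited as a fact).
-/

namespace Summit.BirchSwinnertonDyer.Rank1Residual.X5.SelmerSolitaire.Alt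

open Matrix Finset

variable {n m R : Type*} [CommRing R]

/-! ### §1 The quadratic form of an alternating matrix vanishes (characteristic 2) -/

/-- **`vᵀ S v = 0`** for a symmetric matrix `S` with zero diagonal over a commutative ring of
characteristic `2`: the `(i,j)` and `(j,i)` terms of `∑ᵢⱼ vᵢ Sᵢⱼ vⱼ` cancel in pairs and the diagonal
terms vanish. (Over `𝔽₂`: a simple graph's adjacency matrix is alternating.) [folklore] -/
theorem quadForm_eq_zero [Fintype n] [CharP R 2] {S : Matrix n n R} (hS : S.IsSymm)
    (hd : ∀ i, S i i = 0) (v : n → R) : v ⬝ᵥ (S *ᵥ v) = 0 := by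
  classical
  simp only [dotProduct, mulVec, Finset.mul_sum]
  rw [← Finset.sum_product' (f := fun i j => v i * (S i j * v j))]
  refine Finset.sum_involution (fun ij _ => (ij.2, ij.1)) ?_ ?_ (fun _ _ => Finset.mem_univ _) ?_
  · rintro ⟨i, j⟩ -
    by_cases hij : i = j
    · subst hij
      simp [hd]
    · have hji : S j i = S i j := hS.apply i j
      dsimp only
      rw [hji]
      have : v i * (S i j * v j) + v j * (S i j * v i) = 2 * (v i * (S i j * v j)) := by ring
      rw [this]
      have h2 : (2 : R) = 0 := by
        have := CharP.cast_eq_zero R 2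
        simpa using this
      rw [h2, zero_mul]
  · rintro ⟨i, j⟩ - h
    dsimp only at h ⊢
    intro hji
    simp only [Prod.mk.injEq] at hji
    obtain ⟨rfl, -⟩ := hji
    exact h (by simp [hd])
  · rintro ⟨i, j⟩ -
    rfl

/-- **`C S Cᵀ` has zero diagonal** for `S` symmetric with zero diagonal (characteristic `2`) and ANY
rectangular `C`: its `i`-th diagonal entry is the quadratic form of `S` at the `i`-th row of `C`. This
is the shape of the Schur complement / principal pivot blocks `S₂₂ + S₂₁ S₁₁⁻¹ S₁₂` once `S₁₁⁻¹` is
known to be alternating (§2). [folklore] -/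
theorem diag_conj_eq_zero [Fintype n] [CharP R 2] {S : Matrix n n R} (hS : S.IsSymm)
    (hd : ∀ i, S i i = 0) (C : Matrix m n R) (i : m) : (C * S * Cᵀ) i i = 0 := by
  have h := quadForm_eq_zero hS hd (C i)
  rw [Matrix.mul_assoc]
  simp only [Matrix.mul_apply, Matrix.transpose_apply, dotProduct, mulVec] at h ⊢
  convert h using 2 with j

/-- `C S Cᵀ` is symmetric whenever `S` is (any commutative ring). [folklore] -/
theorem isSymm_conj [Fintype n] {S : Matrix n n R} (hS : S.IsSymm) (C : Matrix m n R) :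
    (C * S * Cᵀ).IsSymm := by
  unfold Matrix.IsSymm at hS ⊢
  rw [Matrix.transpose_mul, Matrix.transpose_mul, Matrix.transpose_transpose, hS, Matrix.mul_assoc]

/-- Sums of alternating matrices are alternating: if `S` and `T` are symmetric with zero diagonal then
so is `S + T` (bookkeeping for `S₂₂ + S₂₁ S₁₁⁻¹ S₁₂`). [folklore] -/
theorem isSymm_add_and_diag {S T : Matrix n n R} (hS : S.IsSymm) (hdS : ∀ i, S i i = 0)
    (hT : T.IsSymm) (hdT : ∀ i, T i i = 0) :
    (S + T).IsSymm ∧ ∀ i, (S + T) i i = 0 :=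
  ⟨hS.add hT, fun i => by simp [hdS i, hdT i]⟩

/-! ### §2 The inverse of a nonsingular alternating matrix is alternating -/

/-- **`(S⁻¹)ᵢᵢ = 0`**: for a symmetric zero-diagonal `S` with `IsUnit S.det` over a commutative ring of
characteristic `2`, the inverse has zero diagonal. Proof: with `w` the `i`-th column of `S⁻¹`,
`S w = eᵢ`, so `(S⁻¹)ᵢᵢ = wᵢ = wᵀ (S w) = 0` by §1 — no cofactor expansion needed. [folklore] -/
theorem inv_diag_eq_zero [Fintype n] [DecidableEq n] [CharP R 2] {S : Matrix n n R}
    (hS : S.IsSymm) (hd : ∀ i, S i i = 0) (hdet : IsUnit S.det) (i : n) : S⁻¹ i i = 0 := by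
  set w : n → R := fun j => S⁻¹ j i with hw
  have hSw : S *ᵥ w = Pi.single i 1 := by
    ext j
    have h := congrFun (congrFun (Matrix.mul_nonsing_inv S hdet) j) i
    simpa [Matrix.mul_apply, mulVec, dotProduct, hw, Matrix.one_apply, Pi.single_apply, eq_comm]
      using h
  have hq := quadForm_eq_zero hS hd w
  rw [hSw, dotProduct_comm, single_one_dotProduct] at hq
  simpa [hw] using hq

/-- **The inverse of a nonsingular alternating matrix is alternating** (characteristic `2`
included): symmetric with zero diagonal. [folklore] -/
theorem inv_isSymm_and_diag_eq_zero [Fintype n] [DecidableEq n] [CharP R 2] {S : Matrix n n R}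
    (hS : S.IsSymm) (hd : ∀ i, S i i = 0) (hdet : IsUnit S.det) :
    S⁻¹.IsSymm ∧ ∀ i, S⁻¹ i i = 0 :=
  ⟨hS.inv, inv_diag_eq_zero hS hd hdet⟩

/-- The principal-pivot / Schur-complement block `T + C S⁻¹ Cᵀ` is alternating when `S` (nonsingular)
and `T` are: symmetric with zero diagonal (characteristic `2`). [folklore] -/
theorem schur_isSymm_and_diag_eq_zero [Fintype n] [DecidableEq n] [CharP R 2] {S : Matrix n n R}
    {T : Matrix m m R}
    (hS : S.IsSymm) (hdS : ∀ i, S i i = 0) (hdet : IsUnit S.det) (hT : T.IsSymm)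
    (hdT : ∀ i, T i i = 0) (C : Matrix m n R) :
    (T + C * S⁻¹ * Cᵀ).IsSymm ∧ ∀ i, (T + C * S⁻¹ * Cᵀ) i i = 0 :=
  isSymm_add_and_diag hT hdT (isSymm_conj hS.inv C)
    (diag_conj_eq_zero hS.inv (inv_diag_eq_zero hS hdS hdet) C)

/-! ### §3 Odd alternating matrices over `𝔽₂` are singular -/

/-- Over `ZMod 2` every Leibniz sign is `1`. [folklore] -/
theorem intCast_sign_eq_one [Fintype n] [DecidableEq n] (σ : Equiv.Perm n) : (((Equiv.Perm.sign σ : ℤˣ) : ℤ) : ZMod 2) = 1 := by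
  rcases Int.units_eq_one_or (Equiv.Perm.sign σ) with h | h <;> rw [h] <;> decide

/-- An involution of a finite set of ODD cardinality has a fixed point (its support has even
cardinality, `Equiv.Perm.two_dvd_card_support`). [folklore] -/
theorem exists_fixed_of_sq_eq_one_of_card_odd [Fintype n] {σ : Equiv.Perm n} (hσ : σ ^ 2 = 1)
    (hn : Odd (Fintype.card n)) : ∃ i, σ i = i := by
  classical
  by_contra h
  push Not at h
  have hsupp : σ.support = Finset.univ := by
    ext i
    simp only [Equiv.Perm.mem_support, Finset.mem_univ, iff_true]
    exact h i
  have h2 := Equiv.Perm.two_dvd_card_support hσ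
  rw [hsupp, Finset.card_univ] at h2
  exact (Nat.not_even_iff_odd.mpr hn) (even_iff_two_dvd.mpr h2)

/-- **A symmetric zero-diagonal matrix over `ZMod 2` of ODD size has determinant `0`** (an alternating
matrix of odd size is singular — in characteristic `2` the usual `det S = det(−Sᵀ)` argument is
empty, so: pair `σ ↔ σ⁻¹` in the Leibniz expansion, the two products agree by symmetry and cancel;
the unpaired `σ` are involutions, which on an odd set fix a point and therefore meet the zero
diagonal). Graph reading: a graph on an odd number of vertices has an even number (zero) of perfect
matchings. [folklore] -/
theorem det_eq_zero_of_card_odd [Fintype n] [DecidableEq n] {S : Matrix n n (ZMod 2)}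
    (hS : S.IsSymm) (hd : ∀ i, S i i = 0) (hn : Odd (Fintype.card n)) : S.det = 0 := by
  classical
  rw [Matrix.det_apply']
  simp_rw [intCast_sign_eq_one, one_mul]
  refine Finset.sum_involution (fun σ _ => σ⁻¹) ?_ ?_ (fun _ _ => Finset.mem_univ _)
    (fun σ _ => inv_inv σ)
  · intro σ _
    have hprod : ∏ i, S (σ⁻¹ i) i = ∏ i, S (σ i) i := by
      rw [← Equiv.prod_comp σ (fun i => S (σ⁻¹ i) i)]
      simp only [Equiv.Perm.coe_inv, Equiv.symm_apply_apply]
      exact Finset.prod_congr rfl fun j _ => (hS.apply j (σ j)).symm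
    rw [hprod]
    exact CharTwo.add_self_eq_zero _
  · intro σ _ hne hinv
    apply hne
    have hσ2 : σ ^ 2 = 1 := by
      rw [pow_two]
      nth_rewrite 2 [← hinv]
      exact mul_inv_cancel σ
    obtain ⟨i, hi⟩ := exists_fixed_of_sq_eq_one_of_card_odd hσ2 hn
    exact Finset.prod_eq_zero (Finset.mem_univ i) (by rw [hi, hd])

/-- **Nonsingular alternating over `𝔽₂` ⟹ even size.** [folklore] -/
theorem even_card_of_det_ne_zero [Fintype n] [DecidableEq n] {S : Matrix n n (ZMod 2)}
    (hS : S.IsSymm) (hd : ∀ i, S i i = 0) (hdet : S.det ≠ 0) : Even (Fintype.card n) := by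
  by_contra h
  exact hdet (det_eq_zero_of_card_odd hS hd (Nat.not_even_iff_odd.mp h))

/-- Principal minors inherit the shape: a principal submatrix (along any reindexing `e`) of a
symmetric zero-diagonal matrix is symmetric with zero diagonal. [folklore] -/
theorem submatrix_isSymm_and_diag {S : Matrix n n R} (hS : S.IsSymm) (hd : ∀ i, S i i = 0)
    (e : m → n) : (S.submatrix e e).IsSymm ∧ ∀ i, S.submatrix e e i i = 0 :=
  ⟨hS.submatrix e, fun i => hd (e i)⟩

/-- Hence an ODD principal minor of an alternating matrix over `𝔽₂` vanishes (the reason the core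
predicate evaluates `det S[n⁺]` with `∞` adjoined exactly when `|n|` is odd). [folklore] -/
theorem det_submatrix_eq_zero_of_card_odd [Fintype m] [DecidableEq m] {S : Matrix n n (ZMod 2)}
    (hS : S.IsSymm) (hd : ∀ i, S i i = 0) (e : m → n) (hm : Odd (Fintype.card m)) :
    (S.submatrix e e).det = 0 :=
  det_eq_zero_of_card_odd (hS.submatrix e) (fun i => hd (e i)) hm

/-! ### §4 `ZMod 2` bookkeeping for the core predicate `det S[n⁺] = 1` -/

/-- In `ZMod 2`, `x = 1 ⟺ x ≠ 0`. [folklore] -/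
theorem eq_one_iff_ne_zero (x : ZMod 2) : x = 1 ↔ x ≠ 0 := by
  revert x; decide

/-- `det S = 1 ⟺ det S ≠ 0` over `ZMod 2` (core ⟺ nonsingular). [folklore] -/
theorem det_eq_one_iff_det_ne_zero [Fintype n] [DecidableEq n] (S : Matrix n n (ZMod 2)) :
    S.det = 1 ↔ S.det ≠ 0 :=
  eq_one_iff_ne_zero _

/-- **Nonsingular ⟺ trivial kernel** over the field `ZMod 2`: `det S ≠ 0 ⟺ ∀ v, S *ᵥ v = 0 → v = 0`
(Mathlib's `Matrix.exists_mulVec_eq_zero_iff`, contraposed) — the form in which kernel vectors are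
TRANSPORTED along the principal pivot (PivotRebase) and along one-vertex extensions (T4).
[folklore] -/
theorem det_ne_zero_iff_forall_mulVec [Fintype n] [DecidableEq n] (S : Matrix n n (ZMod 2)) :
    S.det ≠ 0 ↔ ∀ v, S *ᵥ v = 0 → v = 0 := by
  rw [Ne, ← Matrix.exists_mulVec_eq_zero_iff]
  push Not
  exact ⟨fun h v hv => by_contra fun hv0 => h v hv0 hv, fun h v hv0 hv => hv0 (h v hv)⟩

/-- Core ⟺ trivial kernel, `det = 1` form. [folklore] -/
theorem det_eq_one_iff_forall_mulVec [Fintype n] [DecidableEq n] (S : Matrix n n (ZMod 2)) :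
    S.det = 1 ↔ ∀ v, S *ᵥ v = 0 → v = 0 :=
  (det_eq_one_iff_det_ne_zero S).trans (det_ne_zero_iff_forall_mulVec S)

/-! ### §5 The `ZMod 2` forms consumed BY NAME by `X5/SelmerSolitairePivot.lean` (x11b3-p4, (ii′)
holder): explicit-argument specialisations of §1–§2 (agreed shapes, INBOX 2026-08-21 l.4342). -/

/-- (A2), consumer shape: `v ⬝ᵥ (S *ᵥ v) = 0` for a symmetric zero-diagonal `S` over `ZMod 2`.
[folklore] -/
theorem dotProduct_mulVec_self_eq_zero [Fintype n] (S : Matrix n n (ZMod 2)) (hS : S.IsSymm)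
    (hd : ∀ i, S i i = 0) (v : n → ZMod 2) : v ⬝ᵥ (S *ᵥ v) = 0 :=
  quadForm_eq_zero hS hd v

/-- (A3), consumer shape: the nonsingular inverse of a symmetric zero-diagonal `S` over `ZMod 2` has
zero diagonal. [folklore] -/
theorem nonsing_inv_apply_self_eq_zero [Fintype n] [DecidableEq n] (S : Matrix n n (ZMod 2))
    (hS : S.IsSymm) (hd : ∀ i, S i i = 0) (hu : IsUnit S.det) (i : n) : S⁻¹ i i = 0 :=
  inv_diag_eq_zero hS hd hu i

/-- (A3′), consumer shape: the nonsingular inverse of a symmetric matrix is symmetric (Mathlib's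
`Matrix.IsSymm.inv`, re-exported under the agreed name; any commutative ring). [folklore] -/
theorem isSymm_nonsing_inv_of_isSymm [Fintype n] [DecidableEq n] (S : Matrix n n R)
    (hS : S.IsSymm) : S⁻¹.IsSymm :=
  hS.inv

end Summit.BirchSwinnertonDyer.Rank1Residual.X5.SelmerSolitaire.Alt
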